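import Summits.ResolutionOfSingularities.ResolutionOfSingularities.Theorems.MarkedTransferCampaignW46ThreefoldsGammaFreeGlobalLadder
import HarnessLib

/-!
# [OURS · L1 W4.6 rung (ii)] THE HOST-SHAPE DIMENSION LADDER — stmt-16156's literal text (marked resolution WITH snc boundary)
# with the dimension bound as a parameter: `CampaignW46.HypersurfaceOrderReductionDimLE p d` (statement-only typing + nesting)

Everything here is OURS. `HypersurfaceOrderReductionDimLE p d` = the route item MarkedTransfer `HypersurfaceOrderReductionDimLeThree`
(stmt-ResolutionOfSingularities-16156) read PER PRIME with `3 ↦ d`, binders and conclusion otherwise byte-identical (universe 0, as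
the route file); the identification `HypersurfaceOrderReductionDimLeThree ↔ ∀ p, HypersurfaceOrderReductionDimLE p 3` is `Iff.rfl` up
to the numeral cast and is filed as the LEAF `…W46HostLadderCalibration.lean` importing the route file (this module stays
route-independent: gate rule «theses-cone»). Typed by res-L1-type-o1 (OURS typer o1, gen 6, 2026-08-27) on res-D-pv-047 AS
res-L1-s46-pv-10's WORD 2026-08-27T05:10:19Z (who TAKES `hypersurfaceOrderReductionDimLE_one : … p 1`); name as the prover suggested.
Host: `--supports stmt-ResolutionOfSingularities-16156 --as helper`. It is STRONGER than the Γ-free ladder rung `GammaFreeGlobalOrderReductionDimLE.{0} p d` (`gammaFreeGlobalDimLE_of_host`, via the calibration core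
`isPermissibleBlowupSeq_and_idealOrder_lt_of_isMarkedResolution` with the empty boundary). NAMED RUNG (RUNG MAP (ii-1⁺)):
`d = 1` — a genuine partial result on stmt-16156 itself (regular curves: the boundary bookkeeping is points). Nothing here is a
statement of Hironaka's manuscript; no typed candidate, no FACT. VACUITY: `d = 0` forces `I = ⊤` and is the trivial slice
(disclosed); `d ≥ 1` contentful; not trivially false (true classically for `d ≤ 3`; Cossart–Piltant for `d = 3` — context only, not used).
AI-WRITTEN; NO expert review; AI review is weaker than expert review.
-/

noncomputable section

set_option linter.dupNamespace false -- mandated namespace of this single-conjunct summit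

open CategoryTheory AlgebraicGeometry TopologicalSpace

namespace Summit.ResolutionOfSingularities.ResolutionOfSingularities.Theorems

namespace CampaignW46

open Literature.AlgebraicGeometry.Resolution
open Scheme.IdealSheafData

/-- [OURS · L1 W4.6 rung (ii)] replaces the role of «(ii) threefold hypersurfaces … where MarkedTransfer
`HypersurfaceOrderReductionDimLeThree` applies», IN THE HOST ITEM'S OWN WORDS (marked resolution with snc boundary, BGMW
Def. 3.1.3/3.1.4) and as a LADDER in the dimension bound `d`; NOT a statement of the manuscript: for prime `p`, every perfect
field `k` of characteristic `p`, every separated, locally-of-finite-type, quasi-compact, integral, regular `k`-scheme `X` with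
`topologicalKrullDim X ≤ d`, every effective Cartier `I ≠ 0`, every snc boundary `E` and every `m ≥ 1`, the marked ideal
`(I, E, m)` admits a marked resolution `Φ : X′ → X`, `M′` (`IsMarkedResolution`). Text = stmt-16156's with `∀ p, p.Prime →`
replaced by the parameter and `3 ↦ d`. [folklore] -/
def HypersurfaceOrderReductionDimLE (p d : ℕ) : Prop :=
  p.Prime → ∀ (k : Type) [Field k] [CharP k p] [PerfectField k] (X : AlgebraicGeometry.Scheme.{0})
    (s : X ⟶ AlgebraicGeometry.Spec (.of k)), AlgebraicGeometry.IsSeparated s → AlgebraicGeometry.LocallyOfFiniteType s →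
      AlgebraicGeometry.QuasiCompact s → AlgebraicGeometry.IsIntegral X → Literature.AlgebraicGeometry.Resolution.Scheme.IsRegular X →
        topologicalKrullDim X ≤ d → ∀ (I : X.IdealSheafData), I ≠ ⊥ → Literature.AlgebraicGeometry.Resolution.IsEffectiveCartier I →
          ∀ (E : List X.IdealSheafData), Literature.AlgebraicGeometry.Resolution.HasSNC E → ∀ (m : ℕ), 1 ≤ m →
            ∃ (X' : AlgebraicGeometry.Scheme.{0}) (Φ : X' ⟶ X) (M' : Literature.AlgebraicGeometry.Resolution.MarkedIdeal X'),
              Literature.AlgebraicGeometry.Resolution.IsMarkedResolution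
                (⟨I, E, m⟩ : Literature.AlgebraicGeometry.Resolution.MarkedIdeal X) Φ M'

namespace HypersurfaceOrderReductionDimLE

/-- Pure logic: the host-shape ladder is antitone in the dimension bound. [folklore] -/
theorem of_le {p d d' : ℕ} (hdd : d ≤ d') (h : HypersurfaceOrderReductionDimLE p d') : HypersurfaceOrderReductionDimLE p d := by
  intro hp k _ _ _ X s hsep hloft hqc hint hreg hdim I hI hIc E hE m hm
  exact h hp k X s hsep hloft hqc hint hreg (hdim.trans (by exact_mod_cast hdd)) I hI hIc E hE m hm

end HypersurfaceOrderReductionDimLE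

/-- **The host-shape rung gives the Γ-free rung at the same `d`** (universe 0): take the EMPTY boundary (`HasSNC []` holds on a
regular scheme, `hasSNC_nil_of_isRegular`) and read the marked resolution as a sequence of permissible blowing-ups ending below
order `m` (calibration core `isPermissibleBlowupSeq_and_idealOrder_lt_of_isMarkedResolution`, p493059). [folklore] -/
theorem gammaFreeGlobalDimLE_of_host {p d : ℕ} (h : HypersurfaceOrderReductionDimLE p d) :
    GammaFreeGlobalOrderReductionDimLE.{0} p d := by
  intro hp k _ _ _ X s hsep hloft hqc hint hreg hdim I hI hIc m hm
  haveI := hloft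
  haveI : IsLocallyNoetherian X := LocallyOfFiniteType.isLocallyNoetherian s
  obtain ⟨X', Φ, M', hres⟩ := h hp k X s hsep hloft hqc hint hreg hdim I hI hIc [] (hasSNC_nil_of_isRegular hreg) m hm
  exact ⟨X', Φ, M'.ideal, isPermissibleBlowupSeq_and_idealOrder_lt_of_isMarkedResolution hres⟩

end CampaignW46

end Summit.ResolutionOfSingularities.ResolutionOfSingularities.Theorems

end
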